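import Literature.MathematicalPhysics.QuantumLattice.TypeClassSidecarReaderUCellTPrime
import HarnessLib

/-!
# The JOINT `(t', U)`-BOX at `T > 0` from ONE sidecar and ONE Markov certificate: `t'`-transport at the kinematic price
# `16/π²`, `U`-transport free (cross-corner) or kinematic (one anchor)

Family `hubbard` (topic `MathematicalPhysics/QuantumLattice`), seat hubbard-downfold-unc-1 (the `U` direction of «a parameter BOX maps to
a certified word»; here joined with the `t'` leg). The material oracle's cuprate box is a RECTANGLE `(t', U) ∈ [s₀ − σ, s₀ + σ] × [U₁, U₂]`
(fast cell: `(−1/4 ± 1/20) × [15/2, 17/2]` at `n = 7/8`). Two tree facts give its temperature cells from ONE «c2-sector» sidecar at the corner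
`(β, t, s₀, U₂)` and ONE `t' = 0` Markov (C1) certificate at `(β_h, t, 0, U₁)`:

* `t'`-transport (hubbard-thermal-p2, `TypeClassSidecarReaderTPrimeTransport`): a pressure FLOOR moves from `s₀` to `s` at the kinematic price
  `β |s − s₀| 16/π²` (`eventually_mul_sq_le_log_partitionFn_sector_of_tPrime_anchor_floor`), a `t' = 0` Markov CEILING moves to `s` at
  `β_h |s| 16/π²` (`eventually_log_partitionFn_sector_le_of_cornerMarkovCertificate_tPrimeTransport`, `TypeClassSidecarReaderUCellTPrime` §0);
* `U`-transport (this seat, `HubbardTTPrimePressureFloorUTransport` §6): at fixed `s`, the floor at the RIGHT end `U₂` moves down in `U` and the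
  ceiling at the LEFT end `U₁` moves up in `U` for free (`…_of_pressure_bounds_UCell`); from ONE anchor `U₀` both move at kinematic docc prices
  (`…_of_pressure_bounds_anchorU_kinematic`).

Hence (§1, CROSS-CORNER) for every torus limit of the canonical sector Gibbs states at `(β, t, s, U, n)` with `|s| ≤ σ₁`, `|s − s₀| ≤ σ₂`,
`U ∈ [U₁, U₂]` (`0 ≤ n < 2`, `0 < β_h < β`):
`e_Φ(ω) ≤ ((c − β_h μ n) + β_h σ₁ 16/π² + β σ₂ 16/π² − Wnum/Wden)/(β − β_h)`
(`…le_of_c2Check_right_of_{corner,rect}MarkovCertificate_left_tPrimeUBox_allTori`, decimal edition `16212/10000`); and (§2, ONE `U`-ANCHOR `U₀`, both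
certificates at `U₀`) the same with `+ β_h·max(U₀ − U, 0)·n/2` on the ceiling and `− β·max(U − U₀, 0)·n/2` on the floor
(`…_of_c2Check_of_{corner,rect}MarkovCertificate_tPrimeUBox_allTori_anchorU_kinematic`). ONE sidecar at the box's upper-right corner `(s₀, U₂)` and
ONE C1 at `(0, U₁)` therefore word the WHOLE rectangle; the prices are `β σ₂ 16/π²` (cold input, `σ₂` = half-width of the `t'`-box) and
`β_h σ₁ 16/π²` (hot input, `σ₁ = max |t'|`), nothing in `U`.

Everything is PROVED; no definition, no named fact, no number. HONEST SCOPE: the `t'`-prices are kinematic (`16/π²` per unit `t'` per site);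
certified thermal `⟨K₂⟩` words or sidecars at more `t'` values would cut them; nothing moves in `β`. WHAT THIS IS NOT: no certificate, no phase sentence.

## Mathlib / tree search

REUSED: `eventually_mul_sq_le_log_partitionFn_sector_of_tPrime_anchor_floor`, `sixteen_div_pi_sq_lt` (`TypeClassSidecarReaderTPrimeTransport`);
`eventually_log_partitionFn_sector_le_of_cornerMarkovCertificate_tPrimeTransport` (`TypeClassSidecarReaderUCellTPrime` §0);
`IsTorusLimitOfMixture.meanEnergy_hubbardTTPrime_le_of_pressure_bounds_UCell`, `…_of_pressure_bounds_anchorU_kinematic`, `density_nonneg_of_type`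
(`HubbardTTPrimePressureFloorUTransport` §6); `eventually_pressureFloor_of_c2Check_of_le_U` (`TypeClassSidecarReaderUBox` §2); `c2Check_sound`;
rectangle bookkeeping (`HubbardTorusMarkovRectWindow`). `rg 'tPrimeUBox' Literature/MathematicalPhysics/QuantumLattice` (2026-08-27): nothing.

## References

* R. B. Israel, *Convexity in the Theory of Lattice Gases* (1979), Thm. I.3.4, Lemma II.3.1. [cite: Israel1979, Thm. I.3.4] [cite: Israel1979, Lemma II.3.1]
* E. H. Lieb, Commun. Math. Phys. 31 (1973) 327, §V (5.2)–(5.4) (Peierls–Bogoliubov). [cite: Lieb1973, §V (5.2)–(5.4)]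
* E. H. Lieb, M. Loss, *Analysis* (2001), §8, Theorem 8.2. [cite: LiebLoss1993, §8, Theorem 8.2]
* D. Poulin, M. B. Hastings, Phys. Rev. Lett. 106 (2011) 080403, eqs. (3)–(8). [cite: PoulinHastings2011, eqs. (3)–(8)]
* D. Ruelle, *Statistical Mechanics: Rigorous Results* (1969), §3.3. [cite: Ruelle1969, §3.3]
-/

noncomputable section

namespace Literature.MathematicalPhysics.QuantumLattice

open Matrix Finset HubbardWave0 ThermodynamicLimit LiebThm1 AndersonCluster Literature.Probability.LatticeModels
open _root_.Filter
open scoped _root_.Topology ComplexOrder BigOperators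

namespace InfVolFermionState

variable {t s U n β : ℝ} {ω : InfVolFermionState 2} {Ls : ℕ → ℕ}

/-! ### §1 Cross-corner `(t', U)`-box: sidecar at `(s₀, U₂)`, corner C1 at `(0, U₁)` -/

/-- **JOINT `(t', U)`-BOX upper edge, NO `U`-price.** `ω` a torus limit of the canonical sector Gibbs states at `(β, t, s, U, n)` along any
`Ls → ∞` (`0 ≤ n < 2` via the type, `0 < β_h < β`), `|s| ≤ σ₁`, `|s − s₀| ≤ σ₂`, `U ∈ [U₁, U₂]`. Data: a checked «c2-sector» sidecar AT
`(β, t, s₀, U₂)` (claim node on `hubbardOpenBoxTT' a b t s₀ U₂`, density `n (q a b) = 2A₀`); a `t' = 0` CORNER Markov certificate at `(β_h, μ, U₁)`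
(window `Λ`, corner `x₀`, structured annihilator, dual `L_B`, constant `c`). Then
`e_Φ(ω) ≤ ((c − β_h μ n) + β_h σ₁ 16/π² + β σ₂ 16/π² − Wnum/Wden)/(β − β_h)`.
[cite: Israel1979, Lemma II.3.1] [cite: Israel1979, Thm. I.3.4] [cite: Lieb1973, §V (5.2)–(5.4)] [cite: PoulinHastings2011, eqs. (3)–(8)] -/
theorem IsTorusLimitOfMixture.meanEnergy_hubbardTTPrime_le_of_c2Check_right_of_cornerMarkovCertificate_left_tPrimeUBox_allTori
    (hn2 : n < 2) {s₀ σ₁ σ₂ : ℝ} (hσ₁ : |s| ≤ σ₁) (hσ₂ : |s - s₀| ≤ σ₂) {U₁ U₂ : ℝ} (hU : U ∈ Set.Icc U₁ U₂)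
    (h : ω.IsTorusLimitOfMixture (sectorGibbsCount n) (fun L => sectorGibbsWeightTT' β t s U n L)
      (fun L => sectorGibbsVectorTT' t s U n L) Ls)
    (hLs : Tendsto Ls atTop atTop) {βh : ℝ} (hβh : 0 < βh) (hlt : βh < β)
    -- C2 at `(β, t, s₀, U₂)`
    {a b : ℕ} (ha : 1 ≤ a) (hb : 1 ≤ b) {rows : List C2Row} {P K q A₀ : ℕ} {Wnum : ℤ} {Wden : ℕ}
    (hcheck : c2Check P K q A₀ a b rows Wnum Wden = true) (hn : n * ((q : ℝ) * a * b) = 2 * A₀)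
    (hnode : ∀ r ∈ rows,
      r.floor ≤ (partitionFn β (spinSectorHamiltonian r.nu r.nd (hubbardOpenBoxTT' a b t s₀ U₂))).re)
    -- C1 (corner window, `t' = 0`) at `(βh, μ, U₁)`
    (μ : ℝ) {Λ : Finset (Site 2)} {x₀ : Site 2} (hx₀ : x₀ ∈ Λ) (hmax : ∀ y ∈ Λ, toLex y ≤ toLex x₀)
    (hcorner : ∀ i : Fin 2, x₀ - unitVec i ∈ Λ) {ℓw : ℕ} (hΛ : Λ ⊆ halfOpenBox 2 ℓw)
    {ι : Type*} (sι : Finset ι) (Sw : ι → Finset (Site 2)) (hS : ∀ i, Sw i ⊆ Λ) (zw : ι → Site 2)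
    (hzw : ∀ i, shiftSet (zw i) (Sw i) ⊆ Λ) {O : ∀ i, FermionOp (Sw i)} (hO : ∀ i ∈ sι, (O i).IsHermitian)
    (g : ι → ℝ) {LB : FermionOp (Λ.erase x₀)} (hLB : LB.IsHermitian) {c : ℝ}
    (hcert : ((Real.exp c : ℂ) • cfc Real.exp LB -
      fermionPartialTrace (PolySite.incl (Finset.erase_subset x₀ Λ))
        (cfc Real.exp (-((βh : ℂ) • (cornerEnergyRep Λ x₀ t U₁ μ + windowAnnihilator sι Λ Sw hS zw hzw O g)) +
          fermionEmbed (PolySite.incl (Finset.erase_subset x₀ Λ)) LB))).PosSemidef) :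
    ω.meanEnergy (hubbardTTPrimeFermionInteraction t s U) 1 ≤
      ((c - βh * μ * n) + βh * σ₁ * (16 / Real.pi ^ 2) + β * σ₂ * (16 / Real.pi ^ 2) - (Wnum : ℝ) / Wden) / (β - βh) := by
  obtain ⟨-, hq, -⟩ := c2Check_sound hcheck ha hb
  have hn0 : 0 ≤ n := density_nonneg_of_type ha hb hq hn
  have hβ : 0 < β := hβh.trans hlt
  -- cold input: sidecar floor at `(β, t, s₀, U₂)`, transported to `s` at fixed `U₂`
  have hW0 : ∀ ε : ℝ, 0 < ε → ∀ᶠ j in atTop,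
      ((Wnum : ℝ) / Wden - ε) * (Ls j : ℝ) ^ 2 ≤ Real.log (partitionFn β (sectorHamiltonianTT' t s₀ U₂ n (Ls j))).re :=
    fun ε hε => eventually_pressureFloor_of_c2Check_of_le_U t s₀ n le_rfl hβ.le ha hb hcheck hn hn2.le hnode hLs hε
  have hWs := eventually_mul_sq_le_log_partitionFn_sector_of_tPrime_anchor_floor hn0 hn2 t U₂ hβ s₀ s hLs hW0
  -- hot input: corner C1 at `(βh, t, 0, U₁)`, transported to `s`
  have hu := eventually_log_partitionFn_sector_le_of_cornerMarkovCertificate_tPrimeTransport hn0 hn2 t s U₁ hβh hLs μ hx₀ hmax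
    hcorner hΛ sι Sw hS zw hzw hO g hLB hcert
  have hmain := h.meanEnergy_hubbardTTPrime_le_of_pressure_bounds_UCell hn0 hn2.le hU hLs hβh hlt hWs hu
  refine hmain.trans (div_le_div_of_nonneg_right ?_ (by linarith))
  have hK0 : 0 ≤ 16 / Real.pi ^ 2 := by positivity
  have h1 : βh * |s| * (16 / Real.pi ^ 2) ≤ βh * σ₁ * (16 / Real.pi ^ 2) :=
    mul_le_mul_of_nonneg_right (mul_le_mul_of_nonneg_left hσ₁ hβh.le) hK0
  have h2 : β * |s - s₀| * (16 / Real.pi ^ 2) ≤ β * σ₂ * (16 / Real.pi ^ 2) :=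
    mul_le_mul_of_nonneg_right (mul_le_mul_of_nonneg_left hσ₂ hβ.le) hK0
  linarith

/-- **Rectangle corollary** (`Λ = rectWindow a' b'`, corner `(a' − 1, b' − 1)`, `a', b' ≥ 2`) of the joint `(t', U)`-box upper edge.
[cite: Israel1979, Lemma II.3.1] [cite: Lieb1973, §V (5.2)–(5.4)] [cite: PoulinHastings2011, eqs. (3)–(8)] -/
theorem IsTorusLimitOfMixture.meanEnergy_hubbardTTPrime_le_of_c2Check_right_of_rectMarkovCertificate_left_tPrimeUBox_allTori
    (hn2 : n < 2) {s₀ σ₁ σ₂ : ℝ} (hσ₁ : |s| ≤ σ₁) (hσ₂ : |s - s₀| ≤ σ₂) {U₁ U₂ : ℝ} (hU : U ∈ Set.Icc U₁ U₂)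
    (h : ω.IsTorusLimitOfMixture (sectorGibbsCount n) (fun L => sectorGibbsWeightTT' β t s U n L)
      (fun L => sectorGibbsVectorTT' t s U n L) Ls)
    (hLs : Tendsto Ls atTop atTop) {βh : ℝ} (hβh : 0 < βh) (hlt : βh < β)
    {a b : ℕ} (ha : 1 ≤ a) (hb : 1 ≤ b) {rows : List C2Row} {P K q A₀ : ℕ} {Wnum : ℤ} {Wden : ℕ}
    (hcheck : c2Check P K q A₀ a b rows Wnum Wden = true) (hn : n * ((q : ℝ) * a * b) = 2 * A₀)
    (hnode : ∀ r ∈ rows,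
      r.floor ≤ (partitionFn β (spinSectorHamiltonian r.nu r.nd (hubbardOpenBoxTT' a b t s₀ U₂))).re)
    (μ : ℝ) {a' b' : ℕ} (ha' : 2 ≤ a') (hb' : 2 ≤ b')
    {ι : Type*} (sι : Finset ι) (Sw : ι → Finset (Site 2)) (hS : ∀ i, Sw i ⊆ rectWindow a' b') (zw : ι → Site 2)
    (hzw : ∀ i, shiftSet (zw i) (Sw i) ⊆ rectWindow a' b') {O : ∀ i, FermionOp (Sw i)}
    (hO : ∀ i ∈ sι, (O i).IsHermitian) (g : ι → ℝ)
    {LB : FermionOp ((rectWindow a' b').erase (mkSite2 (a' - 1) (b' - 1)))} (hLB : LB.IsHermitian) {c : ℝ}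
    (hcert : ((Real.exp c : ℂ) • cfc Real.exp LB -
      fermionPartialTrace (PolySite.incl (Finset.erase_subset (mkSite2 (a' - 1) (b' - 1)) (rectWindow a' b')))
        (cfc Real.exp (-((βh : ℂ) • (cornerEnergyRep (rectWindow a' b') (mkSite2 (a' - 1) (b' - 1)) t U₁ μ +
            windowAnnihilator sι (rectWindow a' b') Sw hS zw hzw O g)) +
          fermionEmbed (PolySite.incl (Finset.erase_subset (mkSite2 (a' - 1) (b' - 1)) (rectWindow a' b'))) LB))).PosSemidef) :
    ω.meanEnergy (hubbardTTPrimeFermionInteraction t s U) 1 ≤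
      ((c - βh * μ * n) + βh * σ₁ * (16 / Real.pi ^ 2) + β * σ₂ * (16 / Real.pi ^ 2) - (Wnum : ℝ) / Wden) / (β - βh) :=
  h.meanEnergy_hubbardTTPrime_le_of_c2Check_right_of_cornerMarkovCertificate_left_tPrimeUBox_allTori hn2 hσ₁ hσ₂ hU hLs hβh hlt
    ha hb hcheck hn hnode μ (rectCorner_mem_rectWindow (by omega) (by omega)) toLex_le_toLex_rectCorner
    (rectCorner_sub_unitVec_mem_rectWindow ha' hb') (rectWindow_subset_halfOpenBox_max a' b') sι Sw hS zw hzw hO g hLB hcert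

/-- **Row-file edition** of the rectangle `(t', U)`-box edge (`16/π²` replaced by `16212/10000`):
`e_Φ(ω) ≤ ((c − β_h μ n) + β_h σ₁ (16212/10000) + β σ₂ (16212/10000) − Wnum/Wden)/(β − β_h)` (`σ₁, σ₂ ≥ 0` follow from the hypotheses).
[cite: Israel1979, Lemma II.3.1] [cite: Lieb1973, §V (5.2)–(5.4)] [cite: PoulinHastings2011, eqs. (3)–(8)] -/
theorem IsTorusLimitOfMixture.meanEnergy_hubbardTTPrime_le_of_c2Check_right_of_rectMarkovCertificate_left_tPrimeUBox_allTori'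
    (hn2 : n < 2) {s₀ σ₁ σ₂ : ℝ} (hσ₁ : |s| ≤ σ₁) (hσ₂ : |s - s₀| ≤ σ₂) {U₁ U₂ : ℝ} (hU : U ∈ Set.Icc U₁ U₂)
    (h : ω.IsTorusLimitOfMixture (sectorGibbsCount n) (fun L => sectorGibbsWeightTT' β t s U n L)
      (fun L => sectorGibbsVectorTT' t s U n L) Ls)
    (hLs : Tendsto Ls atTop atTop) {βh : ℝ} (hβh : 0 < βh) (hlt : βh < β)
    {a b : ℕ} (ha : 1 ≤ a) (hb : 1 ≤ b) {rows : List C2Row} {P K q A₀ : ℕ} {Wnum : ℤ} {Wden : ℕ}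
    (hcheck : c2Check P K q A₀ a b rows Wnum Wden = true) (hn : n * ((q : ℝ) * a * b) = 2 * A₀)
    (hnode : ∀ r ∈ rows,
      r.floor ≤ (partitionFn β (spinSectorHamiltonian r.nu r.nd (hubbardOpenBoxTT' a b t s₀ U₂))).re)
    (μ : ℝ) {a' b' : ℕ} (ha' : 2 ≤ a') (hb' : 2 ≤ b')
    {ι : Type*} (sι : Finset ι) (Sw : ι → Finset (Site 2)) (hS : ∀ i, Sw i ⊆ rectWindow a' b') (zw : ι → Site 2)
    (hzw : ∀ i, shiftSet (zw i) (Sw i) ⊆ rectWindow a' b') {O : ∀ i, FermionOp (Sw i)}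
    (hO : ∀ i ∈ sι, (O i).IsHermitian) (g : ι → ℝ)
    {LB : FermionOp ((rectWindow a' b').erase (mkSite2 (a' - 1) (b' - 1)))} (hLB : LB.IsHermitian) {c : ℝ}
    (hcert : ((Real.exp c : ℂ) • cfc Real.exp LB -
      fermionPartialTrace (PolySite.incl (Finset.erase_subset (mkSite2 (a' - 1) (b' - 1)) (rectWindow a' b')))
        (cfc Real.exp (-((βh : ℂ) • (cornerEnergyRep (rectWindow a' b') (mkSite2 (a' - 1) (b' - 1)) t U₁ μ +
            windowAnnihilator sι (rectWindow a' b') Sw hS zw hzw O g)) +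
          fermionEmbed (PolySite.incl (Finset.erase_subset (mkSite2 (a' - 1) (b' - 1)) (rectWindow a' b'))) LB))).PosSemidef) :
    ω.meanEnergy (hubbardTTPrimeFermionInteraction t s U) 1 ≤
      ((c - βh * μ * n) + βh * σ₁ * (16212 / 10000) + β * σ₂ * (16212 / 10000) - (Wnum : ℝ) / Wden) / (β - βh) := by
  have hmain := h.meanEnergy_hubbardTTPrime_le_of_c2Check_right_of_rectMarkovCertificate_left_tPrimeUBox_allTori hn2 hσ₁ hσ₂ hU
    hLs hβh hlt ha hb hcheck hn hnode μ ha' hb' sι Sw hS zw hzw hO g hLB hcert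
  refine hmain.trans (div_le_div_of_nonneg_right ?_ (by linarith))
  have hK := sixteen_div_pi_sq_lt.le
  have hσ₁0 : 0 ≤ σ₁ := (abs_nonneg s).trans hσ₁
  have hσ₂0 : 0 ≤ σ₂ := (abs_nonneg _).trans hσ₂
  have h1 := mul_le_mul_of_nonneg_left hK (mul_nonneg hβh.le hσ₁0)
  have h2 := mul_le_mul_of_nonneg_left hK (mul_nonneg (hβh.trans hlt).le hσ₂0)
  linarith

/-! ### §2 One `U`-anchor `U₀`: both certificates at `U₀`, the `(t', U)`-box at every `U` with kinematic `U`-prices -/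

/-- **JOINT `(t', U)`-box from ONE anchor coupling `U₀`**: sidecar AT `(β, t, s₀, U₀)`, `t' = 0` CORNER Markov certificate at `(β_h, μ, U₀)`;
for every torus limit at `(β, t, s, U, n)` with `|s| ≤ σ₁`, `|s − s₀| ≤ σ₂` (`0 ≤ n < 2`, `0 < β_h < β`):
`e_Φ(ω) ≤ (((c − β_h μ n) + β_h σ₁ 16/π²) + β_h·max(U₀ − U, 0)·n/2 − ((Wnum/Wden − β σ₂ 16/π²) − β·max(U − U₀, 0)·n/2))/(β − β_h)`.
[cite: Israel1979, Lemma II.3.1] [cite: Lieb1973, §V (5.2)–(5.4)] [cite: PoulinHastings2011, eqs. (3)–(8)] -/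
theorem IsTorusLimitOfMixture.meanEnergy_hubbardTTPrime_le_of_c2Check_of_cornerMarkovCertificate_tPrimeUBox_allTori_anchorU_kinematic
    (hn2 : n < 2) {s₀ σ₁ σ₂ : ℝ} (hσ₁ : |s| ≤ σ₁) (hσ₂ : |s - s₀| ≤ σ₂) (U₀ : ℝ)
    (h : ω.IsTorusLimitOfMixture (sectorGibbsCount n) (fun L => sectorGibbsWeightTT' β t s U n L)
      (fun L => sectorGibbsVectorTT' t s U n L) Ls)
    (hLs : Tendsto Ls atTop atTop) {βh : ℝ} (hβh : 0 < βh) (hlt : βh < β)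
    -- C2 at `(β, t, s₀, U₀)`
    {a b : ℕ} (ha : 1 ≤ a) (hb : 1 ≤ b) {rows : List C2Row} {P K q A₀ : ℕ} {Wnum : ℤ} {Wden : ℕ}
    (hcheck : c2Check P K q A₀ a b rows Wnum Wden = true) (hn : n * ((q : ℝ) * a * b) = 2 * A₀)
    (hnode : ∀ r ∈ rows,
      r.floor ≤ (partitionFn β (spinSectorHamiltonian r.nu r.nd (hubbardOpenBoxTT' a b t s₀ U₀))).re)
    -- C1 (corner window, `t' = 0`) at `(βh, μ, U₀)`
    (μ : ℝ) {Λ : Finset (Site 2)} {x₀ : Site 2} (hx₀ : x₀ ∈ Λ) (hmax : ∀ y ∈ Λ, toLex y ≤ toLex x₀)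
    (hcorner : ∀ i : Fin 2, x₀ - unitVec i ∈ Λ) {ℓw : ℕ} (hΛ : Λ ⊆ halfOpenBox 2 ℓw)
    {ι : Type*} (sι : Finset ι) (Sw : ι → Finset (Site 2)) (hS : ∀ i, Sw i ⊆ Λ) (zw : ι → Site 2)
    (hzw : ∀ i, shiftSet (zw i) (Sw i) ⊆ Λ) {O : ∀ i, FermionOp (Sw i)} (hO : ∀ i ∈ sι, (O i).IsHermitian)
    (g : ι → ℝ) {LB : FermionOp (Λ.erase x₀)} (hLB : LB.IsHermitian) {c : ℝ}
    (hcert : ((Real.exp c : ℂ) • cfc Real.exp LB -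
      fermionPartialTrace (PolySite.incl (Finset.erase_subset x₀ Λ))
        (cfc Real.exp (-((βh : ℂ) • (cornerEnergyRep Λ x₀ t U₀ μ + windowAnnihilator sι Λ Sw hS zw hzw O g)) +
          fermionEmbed (PolySite.incl (Finset.erase_subset x₀ Λ)) LB))).PosSemidef) :
    ω.meanEnergy (hubbardTTPrimeFermionInteraction t s U) 1 ≤
      ((((c - βh * μ * n) + βh * σ₁ * (16 / Real.pi ^ 2)) + βh * max (U₀ - U) 0 * (n / 2)) -
        (((Wnum : ℝ) / Wden - β * σ₂ * (16 / Real.pi ^ 2)) - β * max (U - U₀) 0 * (n / 2))) / (β - βh) := by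
  obtain ⟨-, hq, -⟩ := c2Check_sound hcheck ha hb
  have hn0 : 0 ≤ n := density_nonneg_of_type ha hb hq hn
  have hβ : 0 < β := hβh.trans hlt
  have hK0 : 0 ≤ 16 / Real.pi ^ 2 := by positivity
  -- cold input at `(β, t, s, U₀)`: sidecar floor transported along `t'`, weakened to the `σ₂` form
  have hW0 : ∀ ε : ℝ, 0 < ε → ∀ᶠ j in atTop,
      ((Wnum : ℝ) / Wden - ε) * (Ls j : ℝ) ^ 2 ≤ Real.log (partitionFn β (sectorHamiltonianTT' t s₀ U₀ n (Ls j))).re :=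
    fun ε hε => eventually_pressureFloor_of_c2Check_of_le_U t s₀ n le_rfl hβ.le ha hb hcheck hn hn2.le hnode hLs hε
  have hWs := eventually_mul_sq_le_log_partitionFn_sector_of_tPrime_anchor_floor hn0 hn2 t U₀ hβ s₀ s hLs hW0
  have hWs' : ∀ ε : ℝ, 0 < ε → ∀ᶠ j in atTop,
      (((Wnum : ℝ) / Wden - β * σ₂ * (16 / Real.pi ^ 2)) - ε) * (Ls j : ℝ) ^ 2 ≤
        Real.log (partitionFn β (sectorHamiltonianTT' t s U₀ n (Ls j))).re := by
    intro ε hε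
    filter_upwards [hWs ε hε] with j hj
    refine le_trans (mul_le_mul_of_nonneg_right ?_ (sq_nonneg _)) hj
    have h2 : β * |s - s₀| * (16 / Real.pi ^ 2) ≤ β * σ₂ * (16 / Real.pi ^ 2) :=
      mul_le_mul_of_nonneg_right (mul_le_mul_of_nonneg_left hσ₂ hβ.le) hK0
    linarith
  -- hot input at `(βh, t, s, U₀)`: corner C1 transported along `t'`, weakened to the `σ₁` form
  have hu := eventually_log_partitionFn_sector_le_of_cornerMarkovCertificate_tPrimeTransport hn0 hn2 t s U₀ hβh hLs μ hx₀ hmax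
    hcorner hΛ sι Sw hS zw hzw hO g hLB hcert
  have hu' : ∀ ε : ℝ, 0 < ε → ∀ᶠ j in atTop,
      Real.log (partitionFn βh (sectorHamiltonianTT' t s U₀ n (Ls j))).re ≤
        (((c - βh * μ * n) + βh * σ₁ * (16 / Real.pi ^ 2)) + ε) * (Ls j : ℝ) ^ 2 := by
    intro ε hε
    filter_upwards [hu ε hε] with j hj
    refine hj.trans (mul_le_mul_of_nonneg_right ?_ (sq_nonneg _))
    have h1 : βh * |s| * (16 / Real.pi ^ 2) ≤ βh * σ₁ * (16 / Real.pi ^ 2) :=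
      mul_le_mul_of_nonneg_right (mul_le_mul_of_nonneg_left hσ₁ hβh.le) hK0
    linarith
  exact h.meanEnergy_hubbardTTPrime_le_of_pressure_bounds_anchorU_kinematic hn0 hn2.le U₀ hLs hβh hlt hWs' hu'

/-- **Rectangle corollary, row-file edition** of the one-anchor `(t', U)`-box (`16/π²` replaced by `16212/10000` in both prices):
`e_Φ(ω) ≤ (((c − β_h μ n) + β_h σ₁ K) + β_h·max(U₀ − U, 0)·n/2 − ((Wnum/Wden − β σ₂ K) − β·max(U − U₀, 0)·n/2))/(β − β_h)`, `K = 16212/10000`.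
[cite: Israel1979, Lemma II.3.1] [cite: Lieb1973, §V (5.2)–(5.4)] [cite: PoulinHastings2011, eqs. (3)–(8)] -/
theorem IsTorusLimitOfMixture.meanEnergy_hubbardTTPrime_le_of_c2Check_of_rectMarkovCertificate_tPrimeUBox_allTori_anchorU_kinematic'
    (hn2 : n < 2) {s₀ σ₁ σ₂ : ℝ} (hσ₁ : |s| ≤ σ₁) (hσ₂ : |s - s₀| ≤ σ₂) (U₀ : ℝ)
    (h : ω.IsTorusLimitOfMixture (sectorGibbsCount n) (fun L => sectorGibbsWeightTT' β t s U n L)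
      (fun L => sectorGibbsVectorTT' t s U n L) Ls)
    (hLs : Tendsto Ls atTop atTop) {βh : ℝ} (hβh : 0 < βh) (hlt : βh < β)
    {a b : ℕ} (ha : 1 ≤ a) (hb : 1 ≤ b) {rows : List C2Row} {P K q A₀ : ℕ} {Wnum : ℤ} {Wden : ℕ}
    (hcheck : c2Check P K q A₀ a b rows Wnum Wden = true) (hn : n * ((q : ℝ) * a * b) = 2 * A₀)
    (hnode : ∀ r ∈ rows,
      r.floor ≤ (partitionFn β (spinSectorHamiltonian r.nu r.nd (hubbardOpenBoxTT' a b t s₀ U₀))).re)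
    (μ : ℝ) {a' b' : ℕ} (ha' : 2 ≤ a') (hb' : 2 ≤ b')
    {ι : Type*} (sι : Finset ι) (Sw : ι → Finset (Site 2)) (hS : ∀ i, Sw i ⊆ rectWindow a' b') (zw : ι → Site 2)
    (hzw : ∀ i, shiftSet (zw i) (Sw i) ⊆ rectWindow a' b') {O : ∀ i, FermionOp (Sw i)}
    (hO : ∀ i ∈ sι, (O i).IsHermitian) (g : ι → ℝ)
    {LB : FermionOp ((rectWindow a' b').erase (mkSite2 (a' - 1) (b' - 1)))} (hLB : LB.IsHermitian) {c : ℝ}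
    (hcert : ((Real.exp c : ℂ) • cfc Real.exp LB -
      fermionPartialTrace (PolySite.incl (Finset.erase_subset (mkSite2 (a' - 1) (b' - 1)) (rectWindow a' b')))
        (cfc Real.exp (-((βh : ℂ) • (cornerEnergyRep (rectWindow a' b') (mkSite2 (a' - 1) (b' - 1)) t U₀ μ +
            windowAnnihilator sι (rectWindow a' b') Sw hS zw hzw O g)) +
          fermionEmbed (PolySite.incl (Finset.erase_subset (mkSite2 (a' - 1) (b' - 1)) (rectWindow a' b'))) LB))).PosSemidef) :
    ω.meanEnergy (hubbardTTPrimeFermionInteraction t s U) 1 ≤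
      ((((c - βh * μ * n) + βh * σ₁ * (16212 / 10000)) + βh * max (U₀ - U) 0 * (n / 2)) -
        (((Wnum : ℝ) / Wden - β * σ₂ * (16212 / 10000)) - β * max (U - U₀) 0 * (n / 2))) / (β - βh) := by
  have hmain := h.meanEnergy_hubbardTTPrime_le_of_c2Check_of_cornerMarkovCertificate_tPrimeUBox_allTori_anchorU_kinematic hn2
    hσ₁ hσ₂ U₀ hLs hβh hlt ha hb hcheck hn hnode μ (rectCorner_mem_rectWindow (by omega) (by omega)) toLex_le_toLex_rectCorner
    (rectCorner_sub_unitVec_mem_rectWindow ha' hb') (rectWindow_subset_halfOpenBox_max a' b') sι Sw hS zw hzw hO g hLB hcert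
  refine hmain.trans (div_le_div_of_nonneg_right ?_ (by linarith))
  have hK := sixteen_div_pi_sq_lt.le
  have hσ₁0 : 0 ≤ σ₁ := (abs_nonneg s).trans hσ₁
  have hσ₂0 : 0 ≤ σ₂ := (abs_nonneg _).trans hσ₂
  have h1 := mul_le_mul_of_nonneg_left hK (mul_nonneg hβh.le hσ₁0)
  have h2 := mul_le_mul_of_nonneg_left hK (mul_nonneg (hβh.trans hlt).le hσ₂0)
  linarith

end InfVolFermionState

end Literature.MathematicalPhysics.QuantumLattice

end
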